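import Mathlib
import HarnessLib
import Literature.NumberTheory.DiophantineGeometry.AbcWave0
import Literature.NumberTheory.EllipticCurves.HeckeCongruenceModulus
import Literature.NumberTheory.EllipticCurves.DeligneHeckeEigenvalueBound
import Summits.ABC.ABC.Theorems.CongruentialReceptacleReceptacleIdentityStubExistsMonicNatDegree
import Summits.ABC.ABC.Theorems.CongruentialReceptacleReceptacleIdentityStubEvalWindow
import Summits.ABC.ABC.Theorems.CongruentialReceptacleReceptacleIdentityStubHasseWindowArith
import Summits.ABC.ABC.Theorems.CongruentialReceptacleReceptacleIdentityStubFinrankMono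

/-!
# Crux `ReceptacleIdentity` (stmt-ABC-1813), line `Sketch` — the Hasse-window bound for a
# `ℤ/m`-valued Hecke system, and the line's target C⁺ from its two named facts

Two theorems of the line `Sketch` (card `hasse-window-deep-level-lowering`; skeleton
`Cruxes/ReceptacleIdentity/Lines/Sketch.lean`):

* `modulus_le_pow_of_ringHom` — **unconditional**: if `θ : 𝕋(N) → ℤ/m` is a ring map out of
  the anemic Hecke ring `𝕋(N) = ℤ[T_q : q ∤ N] ⊆ End_ℂ S_k(Γ₀(N))` with `θ(T_p) = x ∈ ℤ`
  (`p ∤ N` prime) and every eigenvalue of `T_p` on `S_k(Γ₀(N))` has norm `≤ B < |x|`, then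
  `m ≤ (|x| + B)^(rank_ℝ S_k(Γ₀(N)))`.  Proof: the monic integer polynomial `q` of
  `stub_existsMonicNatDegree` (Shimura's lattice, Cayley–Hamilton; `deg q = rank_ℝ`, roots of norm
  `≤ B`) has `q(T_p) = 0` in `𝕋(N)`, so `q(x) = θ(q(T_p)) = 0` in `ℤ/m`, i.e. `m ∣ q(x)`; and
  `q(x) ≠ 0`, `|q(x)| ≤ (|x|+B)^{deg q}` (`stub_evalWindow`).
* `stub_depthCostsHasseWindowOfFacts` — the registered conditional stub: Deligne's bound
  (`Deligne1974_heckeT_eigenvalue_norm_le`, named fact of the tree) and deep level lowering mod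
  `ℓⁿ` in trace form for Frey curves (the line's second named fact, taken here as an explicit
  hypothesis in expanded form) imply C⁺ = `DepthCostsHasseWindow`: for a Serre-normalised
  abc-triple, odd `p ∣ abc`, prime `ℓ ≥ 5`, `ℓ ∤ abc`, `ℓⁿ ∣ v_p(abc)`, one has
  `ℓⁿ ≤ (1 + √p)^(2 · rank_ℝ S₂(Γ₀((rad(abc)/p)²)))` — with `x = ε(p+1)`, `B = 2√p`,
  `p + 1 + 2√p = (1+√p)²` (`stub_hasseWindowArith`) and monotonicity of the rank in the level
  (`stub_finrankMono`).
-/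

noncomputable section

-- `Summit.ABC.ABC` is the mandated summit-side namespace (single-conjunct summit).
set_option linter.dupNamespace false

open scoped MatrixGroups ModularForm
open CongruenceSubgroup Polynomial
open Literature.NumberTheory.DiophantineGeometry (IsABCTriple rad)
open Literature.NumberTheory.EllipticCurves.ModularForms

namespace Summit.ABC.ABC.Theorems.ReceptacleIdentitySketch

/-- **Hasse-window bound for a `ℤ/m`-valued Hecke system.**  Let `θ : 𝕋(N) → ℤ/m` be a ring
map out of the anemic Hecke ring of `S_k(Γ₀(N))` with `θ(T_p) = x` for a prime `p ∤ N` and an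
integer `x`, and suppose every eigenvalue of `T_p` on `S_k(Γ₀(N))` has norm `≤ B` with
`0 ≤ B < |x|`.  Then `m ≤ (|x| + B)^(rank_ℝ S_k(Γ₀(N)))`.  (Cayley–Hamilton on Shimura's
`T_p`-stable lattice: `m ∣ q(x) ≠ 0`, `|q(x)| ≤ (|x|+B)^{deg q}`.)  Line `Sketch` of crux
stmt-ABC-1813, First lemma in general form. -/
theorem modulus_le_pow_of_ringHom {N : ℕ} [NeZero N] {k : ℤ} {m : ℕ} [NeZero m]
    (θ : anemicHeckeRing N k →+* ZMod m) {p : ℕ} [NeZero p] (hp : p.Prime) (hpN : ¬ p ∣ N)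
    {x : ℤ} (hx : θ (anemicHeckeRing.T N k p hp hpN) = (x : ZMod m))
    {B : ℝ} (hB : 0 ≤ B) (hxB : B < |(x : ℝ)|)
    (hev : ∀ μ : ℂ, Module.End.HasEigenvalue (heckeT (Gamma0 N) k p) μ → ‖μ‖ ≤ B) :
    (m : ℝ) ≤ (|(x : ℝ)| + B) ^ Module.finrank ℝ (CuspForm (Gamma0 N) k) := by
  obtain ⟨q, hmon, hdeg, hq0, hroots⟩ := stub_existsMonicNatDegree N k p hp hev
  obtain ⟨hne, hle⟩ := stub_evalWindow hmon hB hroots hxB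
  set t : anemicHeckeRing N k := anemicHeckeRing.T N k p hp hpN with ht_def
  -- `q(T_p) = 0` inside the Hecke ring
  have ht : aeval t q = 0 := by
    apply Subtype.ext
    have h1 : ((aeval t q : anemicHeckeRing N k) : Module.End ℂ (CuspForm (Gamma0 N) k)) =
        aeval (heckeT (Gamma0 N) k p) q := by
      rw [Polynomial.aeval_subalgebra_coe q (anemicHeckeRing N k) t, ht_def, anemicHeckeRing.coe_T]
    rw [h1, hq0]
    rfl
  -- push through `θ`: `q(x) = 0` in `ℤ/m`
  have hθ : ((q.eval x : ℤ) : ZMod m) = 0 := by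
    have h1 := Polynomial.aeval_algHom_apply θ.toIntAlgHom t q
    simp only [RingHom.toIntAlgHom_coe] at h1
    rw [ht, map_zero, hx] at h1
    have h2 : aeval ((x : ℤ) : ZMod m) q = ((q.eval x : ℤ) : ZMod m) := by
      have := Polynomial.aeval_algebraMap_apply_eq_algebraMap_eval (A := ZMod m) x q
      simpa using this
    rw [← h2, h1]
  have hdvd : (m : ℤ) ∣ q.eval x := (ZMod.intCast_zmod_eq_zero_iff_dvd _ _).mp hθ
  have hmle : (m : ℤ) ≤ |q.eval x| := Int.le_of_dvd (abs_pos.mpr hne) ((dvd_abs _ _).mpr hdvd)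
  have hmleR : (m : ℝ) ≤ |((q.eval x : ℤ) : ℝ)| := by
    have : ((m : ℤ) : ℝ) ≤ ((|q.eval x| : ℤ) : ℝ) := by exact_mod_cast hmle
    simpa [Int.cast_abs] using this
  calc (m : ℝ) ≤ |((q.eval x : ℤ) : ℝ)| := hmleR
    _ ≤ (|(x : ℝ)| + B) ^ q.natDegree := hle
    _ = (|(x : ℝ)| + B) ^ Module.finrank ℝ (CuspForm (Gamma0 N) k) := by rw [hdeg]

/-- **C⁺ from the two named facts** (registered stub `stub_depthCostsHasseWindowOfFacts` of line
`Sketch`, crux stmt-ABC-1813).  Assume (1) Deligne's bound for the eigenvalues of `T_p` on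
`S_k(Γ₀(N))` (`Deligne1974_heckeT_eigenvalue_norm_le`; only its weight-2 case `|μ| ≤ 2√p` is
used) and (2) deep level lowering mod `ℓⁿ` in trace form for Frey curves: for a Serre-normalised
abc-triple (`a ≡ 3 mod 4`, `32 ∣ b`), an odd prime `p ∣ abc`, a prime `ℓ ≥ 5`, `ℓ ∤ abc`, and
`n ≥ 1` with `ℓⁿ ∣ v_p(abc)`, a ring map `θ : 𝕋(L) → ℤ/ℓⁿ` at some level `L`,
`rad(abc)/p ∣ L ∣ (rad(abc)/p)²`, `p ∤ L`, with `θ(T_p) = ε(p+1)`, `ε = ±1`.  Then C⁺ holds: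
`ℓⁿ ≤ (1 + √p)^(2 · rank_ℝ S₂(Γ₀((rad(abc)/p)²)))` — the ℓ-adic depth of `v_p(Δ_min)` costs a
Hasse window (`modulus_le_pow_of_ringHom` with `x = ε(p+1)`, `B = 2√p < p + 1`,
`p + 1 + 2√p = (1+√p)²`, and the rank is monotone in the level). -/
theorem stub_depthCostsHasseWindowOfFacts (hD : Deligne1974_heckeT_eigenvalue_norm_le)
    (hLL : ∀ a b c : ℕ, IsABCTriple a b c → a % 4 = 3 → 32 ∣ b →
      ∀ (p : ℕ) (hp : p.Prime), p ≠ 2 → p ∣ a * b * c →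
      ∀ ℓ : ℕ, ℓ.Prime → 5 ≤ ℓ → ¬ ℓ ∣ a * b * c →
      ∀ n : ℕ, 0 < n → ℓ ^ n ∣ (a * b * c).factorization p →
        ∃ (L : ℕ) (hL : NeZero L) (hpL : ¬ p ∣ L) (ε : ℤ) (θ : anemicHeckeRing L 2 →+* ZMod (ℓ ^ n)),
          rad a b c / p ∣ L ∧ L ∣ (rad a b c / p) ^ 2 ∧ (ε = 1 ∨ ε = -1) ∧
          θ (@anemicHeckeRing.T L hL 2 p ⟨hp.ne_zero⟩ hp hpL) =
            ((ε * (p + 1) : ℤ) : ZMod (ℓ ^ n))) :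
    ∀ a b c : ℕ, IsABCTriple a b c → a % 4 = 3 → 32 ∣ b →
      ∀ p : ℕ, p.Prime → p ≠ 2 → p ∣ a * b * c →
      ∀ ℓ : ℕ, ℓ.Prime → 5 ≤ ℓ → ¬ ℓ ∣ a * b * c →
      ∀ n : ℕ, ℓ ^ n ∣ (a * b * c).factorization p →
        ((ℓ ^ n : ℕ) : ℝ) ≤
          (1 + Real.sqrt p) ^ (2 * Module.finrank ℝ (CuspForm (Gamma0 ((rad a b c / p) ^ 2)) 2)) := by
  intro a b c habc ha hb p hp hp2 hpabc ℓ hℓ hℓ5 hℓabc n hdiv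
  have h1 : (1 : ℝ) ≤ 1 + Real.sqrt p := by
    have := Real.sqrt_nonneg (p : ℝ); linarith
  rcases Nat.eq_zero_or_pos n with hn0 | hn
  · subst hn0
    simpa using one_le_pow₀ (M₀ := ℝ) h1
  obtain ⟨L, instL, hpL, ε, θ, hML, hLM, hε, hθ⟩ :=
    hLL a b c habc ha hb p hp hp2 hpabc ℓ hℓ hℓ5 hℓabc n hn hdiv
  haveI : NeZero p := ⟨hp.ne_zero⟩
  haveI : NeZero (ℓ ^ n) := ⟨pow_ne_zero _ hℓ.ne_zero⟩
  obtain ⟨hlt, hsq⟩ := stub_hasseWindowArith p hp.two_le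
  -- Deligne at level `L`, weight 2
  have hev : ∀ μ : ℂ, Module.End.HasEigenvalue (heckeT (Gamma0 L) 2 p) μ →
      ‖μ‖ ≤ 2 * Real.sqrt p :=
    fun μ hμ ↦ Deligne1974_heckeT_eigenvalue_norm_le.weight_two hD L p hp hpL μ hμ
  have hB : (0 : ℝ) ≤ 2 * Real.sqrt p := by positivity
  have hxabs : |((ε * (p + 1) : ℤ) : ℝ)| = (p : ℝ) + 1 := by
    rcases hε with rfl | rfl
    · push_cast
      rw [one_mul]
      exact abs_of_nonneg (by positivity)
    · push_cast
      rw [neg_one_mul, abs_neg]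
      exact abs_of_nonneg (by positivity)
  have hxB : 2 * Real.sqrt p < |((ε * (p + 1) : ℤ) : ℝ)| := by rw [hxabs]; exact hlt
  have hmain := modulus_le_pow_of_ringHom θ hp hpL hθ hB hxB hev
  rw [hxabs, hsq, ← pow_mul] at hmain
  -- monotonicity of the rank in the level: `L ∣ (rad/p)²`
  have hM0 : rad a b c / p ≠ 0 := by
    intro h0
    rw [h0, zero_dvd_iff] at hML
    exact (NeZero.ne L) hML
  haveI : NeZero ((rad a b c / p) ^ 2) := ⟨pow_ne_zero _ hM0⟩
  have hmono := stub_finrankMono L ((rad a b c / p) ^ 2) 2 hLM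
  calc ((ℓ ^ n : ℕ) : ℝ) ≤ (1 + Real.sqrt p) ^ (2 * Module.finrank ℝ (CuspForm (Gamma0 L) 2)) := by
        exact_mod_cast hmain
    _ ≤ (1 + Real.sqrt p) ^ (2 * Module.finrank ℝ (CuspForm (Gamma0 ((rad a b c / p) ^ 2)) 2)) :=
        pow_le_pow_right₀ h1 (by omega)

end Summit.ABC.ABC.Theorems.ReceptacleIdentitySketch
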